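import Mathlib
import Literature.NumberTheory.LFunctions.DeBruijnHDiv
import Literature.NumberTheory.LFunctions.NewmanProofs
import Literature.Analysis.Complex.LaguerrePolya
import Summits.RiemannHypothesis.RiemannHypothesis.Theorems.UniversalFactorWideTailStandalone
import Summits.RiemannHypothesis.RiemannHypothesis.Theorems.UniversalFactorEntireFactorStandalone

/-!
# RiemannHypothesis / UniversalFactor — `WideKernelNoGo`, route-file-independent

Route `RiemannHypothesis/UniversalFactor`, item **`WideKernelNoGo`** (stmt-RiemannHypothesis-2578): for
`0 < a < π/8` with `∫₀^∞ H_0(x)cosh(ax)dx ≠ 0`, the Laplace-smoothed transform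
`F_a(z) = ∫₀^∞ Φ(u)(1 + u²/a²)⁻¹cos(zu)du` has a non-real zero. This module imports neither the route
file nor any module importing it (see `UniversalFactorH0DecayStandalone.lean`): the theorem
`UniversalFactorStandalone.wideKernelNoGo` states the BODY of the route decl verbatim, so that the item
can be closed `--by` it and the gate can link `WideKernelNoGo_holds` without an import cycle. (The
same result, `UniversalFactor.wideKernelNoGo : UniversalFactor.WideKernelNoGo`, is in
`UniversalFactorWideKernelNoGo.lean`, which imports the route file.)

* `UniversalFactorStandalone.exists_growth_deBruijnHDiv_laplace` — `‖F_a(z)‖ ≤ K e^{‖z‖^{3/2}}`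
  (order `≤ 3/2 < 2`), directly from the majorant `e^{Tu²}|Φ(u)|e^{Yu} ≤ e^{Y√Y}·cubeBound`
  of `NewmanProofs.lean` (no de Bruijn Thm 10 needed);
* `UniversalFactorStandalone.exists_exp_le_norm_deBruijnHDiv_laplace_I` — `|F_a(iy)| ≥ κe^{y}` (`y ≥ 0`);
* **`UniversalFactorStandalone.wideKernelNoGo`**: if all zeros of `F_a` were real, the tail
  `e^{ax}F_a(x) → a∫₀^∞H_0cosh(a·) ≠ 0` (`UniversalFactorStandalone.tendsto_exp_mul_deBruijnHDiv_laplace`)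
  and evenness confine them to a bounded interval, so they are finitely many; dividing them out
  (`UniversalFactorStandalone.exists_zeroFree_factor`) leaves a zero-free real entire `G` of order `< 2`,
  for which the Hadamard-free Laguerre–Pólya lemma `norm_vertical_eq_of_forall_ne_zero` gives
  `‖G(iy)‖ = ‖G(0)‖`, whence `‖F_a(iy)‖ ≤ ‖G(0)‖(y + R)^N` — contradicting `F_a(iy) ≥ κe^{y}`.

References: N. G. de Bruijn, Duke Math. J. 17 (1950); E. C. Titchmarsh, *The theory of the Riemann
zeta-function* (1986), §3.9 Lemma α (behind `LaguerrePolya.lean`); D. A. Cardon, Proc. AMS 130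
(2002), §3 Q. 7.
-/

noncomputable section

namespace Summit.RiemannHypothesis.RiemannHypothesis.Theorems

open MeasureTheory Set Filter Metric Complex
open scoped Topology
open Literature.NumberTheory.LFunctions Literature.Analysis.Complex

/-! ## Growth of `F_a`: order at most `3/2` -/

/-- **`‖F_a(z)‖ ≤ K e^{|Im z|√|Im z|}`**: the integrand of `F_a = deBruijnHDiv (1 + u²/a²)` is dominated
by `C e^{Tu²}|Φ(u)|e^{|Im z|u} ≤ C e^{Y√Y}·cubeBound T u` (`Y = |Im z|`, `Yu ≤ Y√Y + u³`), exactly as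
for `H_t` in `Newman.norm_deBruijnH_le`. [folklore] -/
theorem UniversalFactorStandalone.norm_deBruijnHDiv_laplace_le (a : ℝ) :
    ∃ K : ℝ, 0 ≤ K ∧ ∀ z : ℂ, ‖deBruijnHDiv (fun u : ℝ => 1 + u ^ 2 / a ^ 2) z‖ ≤
      K * Real.exp (|z.im| * Real.sqrt |z.im|) := by
  set m : ℝ → ℝ := fun u ↦ 1 + u ^ 2 / a ^ 2 with hm
  have hadm : IsDivAdmissible m := isDivAdmissible_laplace a
  obtain ⟨C, T, hC, hb⟩ := hadm.exists_bound
  refine ⟨C * ∫ u in Ioi (0 : ℝ), Newman.cubeBound T u,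
    mul_nonneg hC (setIntegral_nonneg measurableSet_Ioi fun u _ ↦ Newman.cubeBound_nonneg T u),
    fun z ↦ ?_⟩
  set Y : ℝ := |z.im| with hY
  have hY0 : 0 ≤ Y := abs_nonneg _
  rw [← divCosMoment_zero, divCosMoment, mul_assoc, mul_comm (∫ u in Ioi (0 : ℝ), Newman.cubeBound T u),
    ← integral_const_mul, ← integral_const_mul]
  refine norm_integral_le_of_norm_le
    ((((Newman.integrableOn_cubeBound T).const_mul _)).const_mul C)
    (ae_restrict_of_forall_mem measurableSet_Ioi fun u (hu : 0 < u) ↦ ?_)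
  calc ‖divCosIntegrand m 0 z u‖ ≤ C * deBruijnHBound T (Y + (0 : ℕ)) u :=
        norm_divCosIntegrand_le hb 0 le_rfl hu
    _ ≤ C * (Real.exp (Y * Real.sqrt Y) * Newman.cubeBound T u) := by
        refine mul_le_mul_of_nonneg_left ?_ hC
        simp only [Nat.cast_zero, add_zero]
        unfold deBruijnHBound Newman.cubeBound
        have : Real.exp (Y * u) ≤ Real.exp (Y * Real.sqrt Y) * Real.exp (u ^ 3) := by
          rw [← Real.exp_add]
          exact Real.exp_monotone (Newman.mul_le_mul_sqrt_add_cube hY0 hu.le)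
        calc Real.exp (T * u ^ 2) * |deBruijnPhi u| * Real.exp (Y * u)
            ≤ Real.exp (T * u ^ 2) * |deBruijnPhi u| *
                (Real.exp (Y * Real.sqrt Y) * Real.exp (u ^ 3)) := by gcongr
          _ = Real.exp (Y * Real.sqrt Y) * (Real.exp (T * u ^ 2) * |deBruijnPhi u| *
                Real.exp (u ^ 3)) := by ring

/-- **`F_a` is of order `< 2`**: `‖F_a(z)‖ ≤ K e^{‖z‖^{3/2}}` for all `z` (`|Im z|√|Im z| ≤ ‖z‖^{3/2}`).
[folklore] -/
theorem UniversalFactorStandalone.exists_growth_deBruijnHDiv_laplace (a : ℝ) :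
    ∃ K : ℝ, ∀ z : ℂ, ‖deBruijnHDiv (fun u : ℝ => 1 + u ^ 2 / a ^ 2) z‖ ≤
      K * Real.exp (‖z‖ ^ (3 / 2 : ℝ)) := by
  obtain ⟨K, hK, h⟩ := UniversalFactorStandalone.norm_deBruijnHDiv_laplace_le a
  refine ⟨K, fun z ↦ (h z).trans ?_⟩
  refine mul_le_mul_of_nonneg_left (Real.exp_le_exp.2 ?_) hK
  have him : |z.im| ≤ ‖z‖ := Complex.abs_im_le_norm z
  calc |z.im| * Real.sqrt |z.im| ≤ ‖z‖ * Real.sqrt ‖z‖ :=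
        mul_le_mul him (Real.sqrt_le_sqrt him) (Real.sqrt_nonneg _) (norm_nonneg _)
    _ = ‖z‖ ^ (3 / 2 : ℝ) := by
        rw [Real.sqrt_eq_rpow, ← Real.rpow_one_add' (norm_nonneg z) (by norm_num)]
        norm_num

/-! ## The Laplace-smoothed transform on the imaginary axis grows exponentially -/

/-- **`F_a(iy) ≥ κ e^{y}` for `y ≥ 0`**: on the imaginary axis
`F_a(iy) = ∫₀^∞ Φ(u)(1 + u²/a²)⁻¹ cosh(yu) du ≥ (e^{y}/2) ∫₁^∞ Φ(u)(1 + u²/a²)⁻¹ du`, and `Φ > 0`.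
(So `F_a` is of order `1` but not of exponential type.) [folklore] -/
theorem UniversalFactorStandalone.exists_exp_le_norm_deBruijnHDiv_laplace_I (a : ℝ) :
    ∃ κ : ℝ, 0 < κ ∧ ∀ y : ℝ, 0 ≤ y →
      κ * Real.exp y ≤ ‖deBruijnHDiv (fun u : ℝ => 1 + u ^ 2 / a ^ 2) (I * y)‖ := by
  set m : ℝ → ℝ := fun u ↦ 1 + u ^ 2 / a ^ 2 with hm
  have hadm : IsDivAdmissible m := isDivAdmissible_laplace a
  set w : ℝ → ℝ := fun u ↦ deBruijnPhi u / m u with hw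
  have hm_pos : ∀ u, 0 < m u := fun u ↦ by positivity
  have hw_pos : ∀ u, 0 ≤ u → 0 < w u := fun u hu ↦
    div_pos (deBruijnPhi_pos_of_nonneg hu) (hm_pos u)
  have hcosI : ∀ y u : ℝ, ((deBruijnPhi u / m u : ℝ) : ℂ) * Complex.cos (I * y * u) =
      ((w u * Real.cosh (y * u) : ℝ) : ℂ) := by
    intro y u
    rw [show I * (y : ℂ) * (u : ℂ) = ((y * u : ℝ) : ℂ) * I by push_cast; ring, Complex.cos_mul_I,
      ← Complex.ofReal_cosh, ← Complex.ofReal_mul]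
  -- the integrand on the imaginary axis is the real function `w(u) cosh(yu)`
  have hint : ∀ y : ℝ, IntegrableOn (fun u : ℝ ↦ w u * Real.cosh (y * u)) (Ioi 0) := by
    intro y
    have h : IntegrableOn (fun u : ℝ ↦
        RCLike.re (((deBruijnPhi u / m u : ℝ) : ℂ) * Complex.cos (I * y * u))) (Ioi 0) :=
      (hadm.integrableOn_deBruijnHDiv (I * y)).re
    refine h.congr_fun (fun u _ ↦ ?_) measurableSet_Ioi
    show RCLike.re (((deBruijnPhi u / m u : ℝ) : ℂ) * Complex.cos (I * y * u)) = w u * Real.cosh (y * u)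
    rw [hcosI, RCLike.re_to_complex, Complex.ofReal_re]
  have hre : ∀ y : ℝ, (deBruijnHDiv m (I * y)).re = ∫ u in Ioi (0:ℝ), w u * Real.cosh (y * u) := by
    intro y
    rw [deBruijnHDiv]
    simp_rw [hcosI]
    rw [integral_complex_ofReal, Complex.ofReal_re]
  -- the constant
  have hint1 : IntegrableOn w (Ioi 1) := by
    have h := (hint 0).mono_set (Ioi_subset_Ioi zero_le_one)
    refine h.congr_fun (fun u _ ↦ ?_) measurableSet_Ioi
    simp
  set κ₀ : ℝ := ∫ u in Ioi (1:ℝ), w u with hκ₀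
  have hκ₀pos : 0 < κ₀ := by
    rw [hκ₀, setIntegral_pos_iff_support_of_nonneg_ae]
    · have hsub : Ioi (1:ℝ) ⊆ Function.support w ∩ Ioi 1 := fun u hu ↦
        ⟨(hw_pos u (by linarith [mem_Ioi.1 hu])).ne', hu⟩
      refine lt_of_lt_of_le ?_ (measure_mono hsub)
      simp
    · exact ae_restrict_of_forall_mem measurableSet_Ioi fun u hu ↦
        (hw_pos u (by linarith [mem_Ioi.1 hu])).le
    · exact hint1
  refine ⟨κ₀ / 2, by positivity, fun y hy ↦ (le_trans ?_ (Complex.re_le_norm _))⟩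
  rw [hre y]
  have h1 : ∫ u in Ioi (1:ℝ), w u * Real.cosh (y * u) ≤ ∫ u in Ioi (0:ℝ), w u * Real.cosh (y * u) :=
    setIntegral_mono_set (hint y)
      (ae_restrict_of_forall_mem measurableSet_Ioi fun u hu ↦
        (mul_pos (hw_pos u (le_of_lt hu)) (Real.cosh_pos _)).le)
      (Ioi_subset_Ioi zero_le_one).eventuallyLE
  have h2 : ∫ u in Ioi (1:ℝ), w u * (Real.exp y / 2) ≤ ∫ u in Ioi (1:ℝ), w u * Real.cosh (y * u) := by
    refine setIntegral_mono_on (hint1.mul_const _) ((hint y).mono_set (Ioi_subset_Ioi zero_le_one))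
      measurableSet_Ioi fun u hu ↦ ?_
    have hu1 : 1 ≤ u := le_of_lt hu
    have hwu : 0 ≤ w u := (hw_pos u (by linarith)).le
    refine mul_le_mul_of_nonneg_left ?_ hwu
    rw [Real.cosh_eq]
    have he : Real.exp y ≤ Real.exp (y * u) := Real.exp_le_exp.2 (by nlinarith)
    have he' : 0 < Real.exp (-(y * u)) := Real.exp_pos _
    linarith
  have h3 : ∫ u in Ioi (1:ℝ), w u * (Real.exp y / 2) = κ₀ * (Real.exp y / 2) := by
    rw [integral_mul_const]
  calc κ₀ / 2 * Real.exp y = κ₀ * (Real.exp y / 2) := by ring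
    _ = ∫ u in Ioi (1:ℝ), w u * (Real.exp y / 2) := h3.symm
    _ ≤ ∫ u in Ioi (1:ℝ), w u * Real.cosh (y * u) := h2
    _ ≤ ∫ u in Ioi (0:ℝ), w u * Real.cosh (y * u) := h1

/-! ## `WideKernelNoGo` -/

/-- **`WideKernelNoGo`** (route `UniversalFactor`, item stmt-RiemannHypothesis-2578; the BODY of the route
decl, verbatim): for `0 < a < π/8` with `∫₀^∞ H_0(x)cosh(ax)dx ≠ 0`, the Laplace-smoothed transform
`F_a(z) = ∫₀^∞ Φ(u)(1 + u²/a²)⁻¹cos(zu)du` does NOT have only real zeros — no WIDE Pólya-frequency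
smoothing of `Ξ` is in the Laguerre–Pólya class. If all zeros of `F_a` were real: the tail
`e^{ax}F_a(x) → a∫₀^∞H_0cosh(a·) ≠ 0` and evenness put them in a bounded real interval, hence
(isolated zeros) there are finitely many; dividing them out leaves a zero-free real entire `G` of
order `< 2` with `‖G(iy)‖ = ‖G(0)‖` (`norm_vertical_eq_of_forall_ne_zero`), so
`‖F_a(iy)‖ ≤ ‖G(0)‖(y + R)^N`, contradicting `F_a(iy) ≥ κe^{y}` (`Φ > 0`). [folklore] -/
theorem UniversalFactorStandalone.wideKernelNoGo :
    ∀ a : ℝ, 0 < a → a < Real.pi / 8 →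
      (∫ x in Set.Ioi (0:ℝ), Literature.NumberTheory.LFunctions.deBruijnH 0 (x : ℂ) *
          (Real.cosh (a * x) : ℂ)) ≠ 0 →
        ¬ Literature.NumberTheory.LFunctions.HasOnlyRealZeros (fun z : ℂ => ∫ u in Set.Ioi (0:ℝ),
          ((Literature.NumberTheory.LFunctions.deBruijnPhi u / (1 + u ^ 2 / a ^ 2) : ℝ) : ℂ) *
            Complex.cos (z * u)) := by
  intro a ha haπ hC hZ
  set m : ℝ → ℝ := fun u ↦ 1 + u ^ 2 / a ^ 2 with hm
  set F : ℂ → ℂ := deBruijnHDiv m with hFdef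
  have hZ' : ∀ z, F z = 0 → z.im = 0 := fun z hz ↦ hZ z hz
  have hFd : Differentiable ℂ F := differentiable_deBruijnHDiv_laplace a
  have hFreal : ∀ x : ℝ, (F x).im = 0 := fun x ↦ deBruijnHDiv_ofReal_im m x
  have hFeven : ∀ z, F (-z) = F z := fun z ↦ deBruijnHDiv_neg m z
  obtain ⟨C, hgr⟩ := UniversalFactorStandalone.exists_growth_deBruijnHDiv_laplace a
  -- the tail: `F x ≠ 0` for large real `x`
  have hT' : Tendsto (fun x : ℝ ↦ Complex.exp ((a : ℂ) * x) * F x) atTop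
      (𝓝 ((a : ℂ) * ∫ y in Set.Ioi (0:ℝ), deBruijnH 0 (y : ℂ) * (Real.cosh (a * y) : ℂ))) :=
    UniversalFactorStandalone.tendsto_exp_mul_deBruijnHDiv_laplace ha haπ
  have hlim : ((a : ℂ) * ∫ y in Set.Ioi (0:ℝ), deBruijnH 0 (y : ℂ) * (Real.cosh (a * y) : ℂ)) ≠ 0 :=
    mul_ne_zero (by exact_mod_cast ha.ne') hC
  obtain ⟨X, hX⟩ := Filter.eventually_atTop.1 (hT'.eventually_ne hlim)
  have hFne : ∀ x : ℝ, X ≤ x → F x ≠ 0 := fun x hx h ↦ hX x hx (by rw [h, mul_zero])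
  -- all zeros of `F` lie in `‖z‖ < R`
  set R : ℝ := max X 0 + 1 with hR
  have hzeros : ∀ z, F z = 0 → ‖z‖ < R := by
    intro z hz
    have him : z.im = 0 := hZ' z hz
    have hzre : z = ((z.re : ℝ) : ℂ) := Complex.ext (by simp) (by simp [him])
    by_contra hge
    push Not at hge
    have hnorm : ‖z‖ = |z.re| := by rw [hzre, Complex.norm_real, Real.norm_eq_abs, Complex.ofReal_re]
    rw [hnorm] at hge
    rcases le_or_gt 0 z.re with h | h
    · rw [abs_of_nonneg h] at hge
      refine hFne z.re (by linarith [le_max_left X 0]) ?_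
      rw [← hzre]; exact hz
    · rw [abs_of_neg h] at hge
      refine hFne (-z.re) (by linarith [le_max_left X 0]) ?_
      rw [Complex.ofReal_neg, hFeven, ← hzre]; exact hz
  -- `F 0 ≠ 0`
  obtain ⟨κ, hκ, hlow⟩ := UniversalFactorStandalone.exists_exp_le_norm_deBruijnHDiv_laplace_I a
  have hF0 : F 0 ≠ 0 := by
    intro h
    have h1 := hlow 0 le_rfl
    rw [Complex.ofReal_zero, mul_zero, Real.exp_zero, mul_one] at h1
    have h2 : ‖deBruijnHDiv (fun u : ℝ => 1 + u ^ 2 / a ^ 2) 0‖ = 0 := by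
      rw [show deBruijnHDiv (fun u : ℝ => 1 + u ^ 2 / a ^ 2) 0 = F 0 from rfl, h, norm_zero]
    linarith
  -- divide out the zeros
  obtain ⟨S, mult, G, hS, hSR, hGd, hG0, hfac⟩ :=
    UniversalFactorStandalone.exists_zeroFree_factor hFd hF0 hzeros
  have hSreal : ∀ b ∈ S, b.im = 0 := fun b hb ↦ hZ' b (hS b hb)
  have hGreal : ∀ x : ℝ, (G x).im = 0 := fun x ↦
    UniversalFactorStandalone.im_factor_ofReal_eq_zero x hGd hfac hFreal hSreal
  obtain ⟨C', -, hgr'⟩ := UniversalFactorStandalone.exists_growth_factor hGd hfac hgr hSR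
  have hGI : ∀ y : ℝ, ‖G (I * y)‖ = ‖G 0‖ := fun y ↦ by
    have h := norm_vertical_eq_of_forall_ne_zero hGd (ρ := 3 / 2) (by norm_num) (by norm_num) hgr'
      hGreal hG0 0 y
    simpa using h
  -- polynomial upper bound against exponential lower bound on the imaginary axis
  refine UniversalFactorStandalone.false_of_exp_le_pow (K := ‖G 0‖) (R := R) (N := ∑ b ∈ S, mult b)
    (fun y hy ↦ ?_) hκ
  have hIy : ‖I * (y : ℂ)‖ = y := by
    rw [norm_mul, Complex.norm_I, one_mul, Complex.norm_real, Real.norm_eq_abs, abs_of_nonneg hy]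
  calc κ * Real.exp y ≤ ‖F (I * y)‖ := hlow y hy
    _ = ‖∏ b ∈ S, (I * y - b) ^ mult b‖ * ‖G (I * y)‖ := by rw [hfac, norm_mul]
    _ ≤ (‖I * (y : ℂ)‖ + R) ^ (∑ b ∈ S, mult b) * ‖G 0‖ := by
        rw [hGI]
        exact mul_le_mul_of_nonneg_right
          (UniversalFactorStandalone.norm_prod_pow_sub_le_pow mult (fun b hb ↦ (hSR b hb).le) _)
          (norm_nonneg _)
    _ = ‖G 0‖ * (y + R) ^ (∑ b ∈ S, mult b) := by rw [hIy, mul_comm]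

end Summit.RiemannHypothesis.RiemannHypothesis.Theorems
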